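import Mathlib.Probability.Distributions.Gaussian.Real
import Mathlib.MeasureTheory.Measure.Lebesgue.Integral
import HarnessLib

/-!
# The Gaussian model of the energy violation: Creutz forces `σ² = 2⟨ΔH⟩`, and then `⟨P_acc⟩ = 2·P(ΔH ≤ 0) = erfc(½√⟨ΔH⟩)`

HONEST FRAMING: exact (Metropolis-corrected) sampling algorithms for lattice gauge theory;
figures of merit are autocorrelation/cost numbers at stated couplings and volumes; no
continuum-physics claim.  (SCALAR calibration rung S0-A: not a gauge result.)

Venture `LatticeQCDFlow` (cell pub-lqcd), sub-topic `Scoring`; FANOUT row 2 (`s0-phi4`: the HMC arm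
of the 2D φ⁴ calibration — the acceptance predictor used when tuning step sizes).  NEW WORK of the
cell over Mathlib's `gaussianReal` (`mgf_id_gaussianReal`, `integral_gaussianReal_eq_integral_smul`);
nothing is cited as a fact.  Printed counterparts, named only: Gupta–Irbäck–Karsch–Petersson 1990
and Kennedy–Pendleton 1991 (`⟨P_acc⟩ = erfc(½√⟨ΔH⟩)` for Gaussian `ΔH`), Creutz 1988.

The `erfc` law is a statement about a MODEL: "the energy violation `ΔH` is Gaussian".  This file
types exactly what that model implies, so that the battery can use the formula with its hypothesis
visible:

* `gaussian_integral_exp_neg` — for `ΔH ∼ N(m, v)`: `⟨e^{−ΔH}⟩ = e^{−m + v/2}`;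
  **`gaussian_creutz_iff`** — Creutz's identity `⟨e^{−ΔH}⟩ = 1` holds in the model IFF `v = 2m`
  (so `Var(ΔH) = 2⟨ΔH⟩` is not an approximation but the model's consistency condition; compare the
  exact per-mode law of free-field leapfrog, `Var = 2m(1 + m)`, in
  `Scoring/FreeFieldLeapfrogEnergyVariance.lean` — the per-mode law is not Gaussian).
* `gaussianPDFReal_tilt` — the tilt identity `e^{−x} φ_{m,2m}(x) = φ_{m,2m}(−x)`;
  **`gaussian_acceptance`** — for `ΔH ∼ N(m, 2m)`, `m > 0`:
  `⟨min(1, e^{−ΔH})⟩ = 2 · P(ΔH ≤ 0)` (`= 2Φ(−√(m/2)) = erfc(½√m)`; the standard-normal rewriting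
  is left as this remark), consistent with the model-free identity
  `⟨P_acc⟩ = P(ΔH ≤ 0) + P(ΔH < 0)` of `Exactness/Phi4HMCFluctuationRelation.lean` and the
  model-free bound `1 − ⟨P_acc⟩ ≤ √(1 − e^{−m})` of `Exactness/AcceptanceFromMeanEnergyViolation.lean`.
NOT CLAIMED: that any HMC's `ΔH` is Gaussian (it is only asymptotically so, by a CLT over modes).
-/

namespace Summit.Ventures.LatticeQCDFlow.Scoring

open Real MeasureTheory ProbabilityTheory Set Filter

/-- **`⟨e^{−ΔH}⟩` in the Gaussian model**: `∫ e^{−x} dN(m, v) = e^{−m + v/2}`. -/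
theorem gaussian_integral_exp_neg (m : ℝ) (v : NNReal) :
    ∫ x, Real.exp (-x) ∂gaussianReal m v = Real.exp (-m + v / 2) := by
  have h := congrFun (mgf_id_gaussianReal (μ := m) (v := v)) (-1)
  simp only [mgf, id_eq, neg_one_mul, mul_neg_one, even_two, Even.neg_pow, one_pow, mul_one] at h
  rw [h]

/-- **CREUTZ'S IDENTITY PINS THE VARIANCE OF THE GAUSSIAN MODEL**: for `ΔH ∼ N(m, v)`,
`⟨e^{−ΔH}⟩ = 1 ↔ v = 2m`. -/
theorem gaussian_creutz_iff (m : ℝ) (v : NNReal) :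
    ∫ x, Real.exp (-x) ∂gaussianReal m v = 1 ↔ (v : ℝ) = 2 * m := by
  rw [gaussian_integral_exp_neg, Real.exp_eq_one_iff]
  constructor <;> intro h <;> linarith

/-- **The tilt identity** of the Creutz-consistent Gaussian: `φ_{m,2m}(x) e^{−x} = φ_{m,2m}(−x)`. -/
theorem gaussianPDFReal_tilt {m : ℝ} (hm : 0 < m) (x : ℝ) :
    gaussianPDFReal m (2 * m).toNNReal x * Real.exp (-x)
      = gaussianPDFReal m (2 * m).toNNReal (-x) := by
  simp only [gaussianPDFReal, Real.coe_toNNReal _ (by positivity : (0 : ℝ) ≤ 2 * m)]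
  rw [mul_assoc, ← Real.exp_add]
  congr 2
  field_simp
  ring

/-- **THE ACCEPTANCE OF THE GAUSSIAN MODEL**: for `ΔH ∼ N(m, 2m)` with `m > 0`,
`∫ min(1, e^{−x}) dN(m, 2m) = 2 · N(m, 2m)(x ≤ 0)` — i.e. `⟨P_acc⟩ = 2Φ(−√(m/2)) = erfc(½√m)`. -/
theorem gaussian_acceptance {m : ℝ} (hm : 0 < m) :
    ∫ x, min 1 (Real.exp (-x)) ∂gaussianReal m (2 * m).toNNReal
      = 2 * (gaussianReal m (2 * m).toNNReal).real (Iic 0) := by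
  set v : NNReal := (2 * m).toNNReal with hv
  have hv0 : v ≠ 0 := by
    rw [hv]
    exact ne_of_gt (Real.toNNReal_pos.2 (by positivity))
  set φ := gaussianPDFReal m v with hφ
  have hφi : Integrable φ := integrable_gaussianPDFReal m v
  have hφ0 : ∀ x, 0 ≤ φ x := gaussianPDFReal_nonneg m v
  -- to a Lebesgue integral with the density
  rw [integral_gaussianReal_eq_integral_smul hv0]
  simp only [smul_eq_mul]
  have hint : Integrable fun x => φ x * min 1 (Real.exp (-x)) := by
    refine Integrable.mono' hφi
      ((measurable_gaussianPDFReal m v).mul (measurable_const.min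
        (Real.measurable_exp.comp measurable_neg))).aestronglyMeasurable
      (Eventually.of_forall fun x => ?_)
    rw [Real.norm_eq_abs, abs_mul, abs_of_nonneg (hφ0 x),
      abs_of_nonneg (le_min zero_le_one (Real.exp_pos _).le)]
    calc φ x * min 1 (Real.exp (-x)) ≤ φ x * 1 :=
          mul_le_mul_of_nonneg_left (min_le_left _ _) (hφ0 x)
      _ = φ x := mul_one _
  -- split at `0`
  rw [← integral_add_compl (measurableSet_Iic (a := (0 : ℝ))) hint, compl_Iic]
  -- left half: `min = 1`
  have hL : ∫ x in Iic (0 : ℝ), φ x * min 1 (Real.exp (-x)) = ∫ x in Iic (0 : ℝ), φ x := by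
    refine setIntegral_congr_fun measurableSet_Iic fun x hx => ?_
    rw [min_eq_left (Real.one_le_exp (neg_nonneg.2 hx)), mul_one]
  -- right half: `min = e^{−x}`, tilt, reflect
  have hR : ∫ x in Ioi (0 : ℝ), φ x * min 1 (Real.exp (-x)) = ∫ x in Iic (0 : ℝ), φ x := by
    have h1 : ∫ x in Ioi (0 : ℝ), φ x * min 1 (Real.exp (-x)) = ∫ x in Ioi (0 : ℝ), φ (-x) := by
      refine setIntegral_congr_fun measurableSet_Ioi fun x hx => ?_
      have hx' : Real.exp (-x) ≤ 1 := Real.exp_le_one_iff.2 (neg_nonpos.2 (le_of_lt hx))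
      rw [min_eq_right hx', hφ, gaussianPDFReal_tilt hm x]
    rw [h1, integral_comp_neg_Ioi 0 φ, neg_zero]
  rw [hL, hR, ← two_mul]
  congr 1
  rw [Measure.real, gaussianReal_apply_eq_integral m hv0,
    ENNReal.toReal_ofReal (setIntegral_nonneg measurableSet_Iic fun x _ => hφ0 x)]

/-- The same with the strict event: `N(m, 2m)` has no atoms, so `P(ΔH ≤ 0) = P(ΔH < 0)` and
`⟨P_acc⟩ = P(ΔH ≤ 0) + P(ΔH < 0)` as in the model-free identity. -/
theorem gaussian_acceptance' {m : ℝ} (hm : 0 < m) :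
    ∫ x, min 1 (Real.exp (-x)) ∂gaussianReal m (2 * m).toNNReal
      = (gaussianReal m (2 * m).toNNReal).real (Iic 0)
        + (gaussianReal m (2 * m).toNNReal).real (Iio 0) := by
  have hv0 : (2 * m).toNNReal ≠ 0 := ne_of_gt (Real.toNNReal_pos.2 (by positivity))
  haveI := nullSingletonClass_gaussianReal (μ := m) hv0
  rw [gaussian_acceptance hm, two_mul]
  congr 1
  exact measureReal_congr Iio_ae_eq_Iic.symm

/-- The Creutz-consistent model indeed satisfies Creutz: `∫ e^{−x} dN(m, 2m) = 1` (`m ≥ 0`). -/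
theorem gaussian_creutz {m : ℝ} (hm : 0 ≤ m) :
    ∫ x, Real.exp (-x) ∂gaussianReal m (2 * m).toNNReal = 1 := by
  rw [gaussian_creutz_iff, Real.coe_toNNReal _ (by positivity)]

end Summit.Ventures.LatticeQCDFlow.Scoring
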